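import Summits.CriticalPhenomena.PercolationContinuityZ3.Theorems.PercNearOneGluingNoHeavyLowerTailSahiCombFiveUpSetRankZ3

/-!
# Reading a zeta relation in the antipodal basis: the DIAGONAL READING rule and the TWO-CLASS EXTENSION rule

Support file of the one-cut programme (crux `NoHeavyLowerTail`, stmt-CriticalPhenomena-4575; TRI lane of cell `prim-masterthm`; seat prim-lf-1 gen 38,
memo `FROM-prim-lf-1-gen38-AN3-KERNEL.md`).  Toolkit for the kernel ("support-chase") proofs of levelled `{0,1}` inclusion designs
(`…SahiCombFiveUpSetProof` = RANK-Z, `…SahiCombFourChainRank` = AN♯1, and the AN♯3 proof `…SahiCombTriWAntiNestedKernelProof` of this seat).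
Those proofs repeatedly expand a zeta combination `zsum x = Σ_d x d · ζ_d` (`ζ_d(t) = [d ⊆ t]`) on an up-set `Y` in the ANTIPODAL BASIS
`{ζ_e|_Y : eᶜ ∈ Y}` (support lemma `exists_support_coef` + C1 `eq_zero_of_zeta_sum_eq_zero`, `…SahiCombFiveUpSetRank`) and use two facts about
the coordinates: a class whose indices `d` all have `dᶜ ∈ Y` IS its own coordinate vector (diagonal), and a class whose indices have `dᶜ ∈ Z`
(`Z` an up-set) has coordinates supported on `refl (Y ∩ Z)`.  The two elimination rules of cell P5 gen 16's elementary prover `cprove2`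
(R2 "single diagonal contributor at an index" and R3 "squeeze") become the following tree lemmas, stated in the `zsum` language of
`…SahiCombFiveUpSetRankZ3` and with rational coefficients so that linear combinations of level equations can be fed in directly:

* **`FiveUpSet.eq_zero_of_zsum_add_zsum_eq_zero`** (DIAGONAL READING) — `x` supported on `refl Y`, `y` on `refl Z`, `zsum x + zsum y = 0` on `Y`
  ⟹ `x e = 0` at every `e` with `eᶜ ∉ Z`; versions `FiveUpSet.diag_read₂` / `FiveUpSet.diag_read₃` with two / three foreign classes and coefficients;
* **`FiveUpSet.zsum_ext₂`** (TWO-CLASS EXTENSION) — `x` supported on `refl Zx`, `y` on `refl Zy`, `a·zsum x + b·zsum y = 0` on `Y` (`a ≠ 0`) and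
  `zsum x = 0` on `Y ∩ Zx ∩ Zy` ⟹ `zsum x = 0` on all of `Y` (the one-class case `y = 0` is the antipodal extension lemma `zsum_ext`);
* `FiveUpSet.zsum_const_mul`, `FiveUpSet.zsum_mul_add_mul` — linearity bookkeeping.
HONEST LABEL: elementary linear algebra over `ℚ` (all proved, std axioms); no inequality is proved in this file. [this work]
-/

namespace Summit.CriticalPhenomena.PercolationContinuityZ3.Theorems

namespace FiveUpSet

open Finset

variable {α : Type} [DecidableEq α] [Fintype α]

/-! ### Linearity bookkeeping -/

/-- `zsum (a·f) = a · zsum f`. [this work] -/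
theorem zsum_const_mul (a : ℚ) (f : Finset α → ℚ) (t : Finset α) : zsum (fun d => a * f d) t = a * zsum f t := by
  unfold zsum
  rw [Finset.mul_sum]
  exact Finset.sum_congr rfl fun d _ => by ring

/-- `zsum (a·f + b·g) = a · zsum f + b · zsum g`. [this work] -/
theorem zsum_mul_add_mul (a b : ℚ) (f g : Finset α → ℚ) (t : Finset α) :
    zsum (fun d => a * f d + b * g d) t = a * zsum f t + b * zsum g t := by
  unfold zsum
  rw [Finset.mul_sum, Finset.mul_sum, ← Finset.sum_add_distrib]
  exact Finset.sum_congr rfl fun d _ => by ring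

/-! ### The diagonal reading rule -/

/-- **DIAGONAL READING.**  `Y, Z` up-sets of the cube; `x` supported on `{d : dᶜ ∈ Y}` (so on `Y` the combination `zsum x` is its own coordinate
vector in the antipodal basis of `ℚ^Y`), `y` supported on `{d : dᶜ ∈ Z}` (so the coordinates of `zsum y|_Y` live on `refl (Y ∩ Z)`).  If
`zsum x + zsum y = 0` on `Y`, then `x e = 0` at every index `e` with `eᶜ ∉ Z`.  Proof: expand `zsum y` on `Y` by the support lemma, then C1 on `Y`
identifies `x` with minus the coordinate vector of `y`. [this work] -/
theorem eq_zero_of_zsum_add_zsum_eq_zero {Y Z : Finset (Finset α)} (hY : IsUpperSet (Y : Set (Finset α)))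
    (hZ : IsUpperSet (Z : Set (Finset α))) (x y : Finset α → ℚ)
    (hx : ∀ d, x d ≠ 0 → dᶜ ∈ Y) (hy : ∀ d, y d ≠ 0 → dᶜ ∈ Z)
    (h : ∀ t, t ∈ Y → zsum x t + zsum y t = 0) : ∀ e, eᶜ ∉ Z → x e = 0 := by
  -- support lemma on `Y`, one coefficient vector per index `d`
  choose c _hcδ hcsupp hcid using fun d => exists_support_coef hY d
  -- the coordinate vector of `y`
  obtain ⟨g, hg⟩ : ∃ f : Finset α → ℚ, ∀ e, f e = ∑ d, y d * c d e := ⟨_, fun _ => rfl⟩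
  -- on `Y`, `zsum y` equals the `g`-combination
  have hexp : ∀ t, t ∈ Y → zsum y t = ∑ e, g e * (if e ⊆ t then (1 : ℚ) else 0) := by
    intro t ht
    have hR : ∑ e, g e * (if e ⊆ t then (1 : ℚ) else 0) = ∑ e, (∑ d, y d * c d e) * (if e ⊆ t then (1 : ℚ) else 0) :=
      Finset.sum_congr rfl fun e _ => by rw [hg e]
    rw [hR]
    unfold zsum
    symm
    calc ∑ e, (∑ d, y d * c d e) * (if e ⊆ t then (1 : ℚ) else 0)
        = ∑ e, ∑ d, y d * (c d e * (if e ⊆ t then (1 : ℚ) else 0)) := by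
          refine sum_congr rfl fun e _ => ?_
          rw [Finset.sum_mul]
          refine sum_congr rfl fun d _ => ?_
          ring
      _ = ∑ d, ∑ e, y d * (c d e * (if e ⊆ t then (1 : ℚ) else 0)) := Finset.sum_comm
      _ = ∑ d, y d * ∑ e, c d e * (if e ⊆ t then (1 : ℚ) else 0) := by
          refine sum_congr rfl fun d _ => ?_
          rw [Finset.mul_sum]
      _ = ∑ d, y d * (if d ⊆ t then (1 : ℚ) else 0) := by
          refine sum_congr rfl fun d _ => ?_
          rw [← hcid d t ht]
  -- `g` is supported on `refl (Y ∩ Z)`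
  have hgsupp : ∀ e, g e ≠ 0 → eᶜ ∈ Y ∧ eᶜ ∈ Z := by
    intro e he
    rw [hg e] at he
    obtain ⟨d, -, hd⟩ := Finset.exists_ne_zero_of_sum_ne_zero he
    have hyd : y d ≠ 0 := left_ne_zero_of_mul hd
    obtain ⟨heY, hed⟩ := hcsupp d e (right_ne_zero_of_mul hd)
    exact ⟨heY, hZ (compl_subset_compl.2 hed) (hy d hyd)⟩
  -- C1 on `Y` for `x + g`
  have hzero : ∀ e, x e + g e = 0 := by
    refine eq_zero_of_zeta_sum_eq_zero hY (fun e => x e + g e) ?_ ?_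
    · intro e he
      by_contra hY'
      have h1 : x e = 0 := by by_contra h'; exact hY' (hx e h')
      have h2 : g e = 0 := by by_contra h'; exact hY' (hgsupp e h').1
      apply he
      rw [h1, h2, add_zero]
    · intro t ht
      have hs : ∑ e, (x e + g e) * (if e ⊆ t then (1 : ℚ) else 0)
          = zsum x t + ∑ e, g e * (if e ⊆ t then (1 : ℚ) else 0) := by
        unfold zsum
        rw [← Finset.sum_add_distrib]
        exact Finset.sum_congr rfl fun e _ => by ring
      rw [hs, ← hexp t ht]
      exact h t ht
  intro e he
  have h2 : g e = 0 := by by_contra h'; exact he (hgsupp e h').2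
  have h3 := hzero e
  rwa [h2, add_zero] at h3

/-- **Diagonal reading with two foreign classes and coefficients.**  `a·zsum x + b₁·zsum y₁ + b₂·zsum y₂ = 0` on the up-set `Y`, `a ≠ 0`,
`x` supported on `{d : dᶜ ∈ Y}`, `yᵢ` on `{d : dᶜ ∈ Zᵢ}` (`Zᵢ` up-sets) ⟹ `x e = 0` whenever `eᶜ ∉ Z₁` and `eᶜ ∉ Z₂`. [this work] -/
theorem diag_read₂ {Y Z₁ Z₂ : Finset (Finset α)} (hY : IsUpperSet (Y : Set (Finset α)))
    (hZ₁ : IsUpperSet (Z₁ : Set (Finset α))) (hZ₂ : IsUpperSet (Z₂ : Set (Finset α))) (x y₁ y₂ : Finset α → ℚ) (a b₁ b₂ : ℚ)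
    (ha : a ≠ 0) (hx : ∀ d, x d ≠ 0 → dᶜ ∈ Y) (hy₁ : ∀ d, y₁ d ≠ 0 → dᶜ ∈ Z₁) (hy₂ : ∀ d, y₂ d ≠ 0 → dᶜ ∈ Z₂)
    (h : ∀ t, t ∈ Y → a * zsum x t + b₁ * zsum y₁ t + b₂ * zsum y₂ t = 0) :
    ∀ e, eᶜ ∉ Z₁ → eᶜ ∉ Z₂ → x e = 0 := by
  have hZ : IsUpperSet ((Z₁ ∪ Z₂ : Finset (Finset α)) : Set (Finset α)) := by
    rw [coe_union]; exact hZ₁.union hZ₂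
  have key := eq_zero_of_zsum_add_zsum_eq_zero hY hZ (fun d => a * x d) (fun d => b₁ * y₁ d + b₂ * y₂ d) ?_ ?_ ?_
  · intro e he₁ he₂
    have hne : eᶜ ∉ Z₁ ∪ Z₂ := by
      rw [mem_union]; rintro (h' | h'); exacts [he₁ h', he₂ h']
    have h0 := key e hne
    rcases mul_eq_zero.1 h0 with h' | h'
    · exact absurd h' ha
    · exact h'
  · intro d hd
    exact hx d (right_ne_zero_of_mul hd)
  · intro d hd
    rw [mem_union]
    by_cases h1 : y₁ d = 0
    · have h2 : y₂ d ≠ 0 := by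
        intro h2; apply hd; rw [h1, h2, mul_zero, mul_zero, add_zero]
      exact Or.inr (hy₂ d h2)
    · exact Or.inl (hy₁ d h1)
  · intro t ht
    rw [zsum_const_mul, zsum_mul_add_mul, ← add_assoc]
    exact h t ht

/-- **Diagonal reading with three foreign classes and coefficients.**  `a·zsum x + b₁·zsum y₁ + b₂·zsum y₂ + b₃·zsum y₃ = 0` on the up-set `Y`,
`a ≠ 0`, `x` supported on `{d : dᶜ ∈ Y}`, `yᵢ` on `{d : dᶜ ∈ Zᵢ}` ⟹ `x e = 0` whenever `eᶜ ∉ Z₁`, `eᶜ ∉ Z₂`, `eᶜ ∉ Z₃`. [this work] -/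
theorem diag_read₃ {Y Z₁ Z₂ Z₃ : Finset (Finset α)} (hY : IsUpperSet (Y : Set (Finset α)))
    (hZ₁ : IsUpperSet (Z₁ : Set (Finset α))) (hZ₂ : IsUpperSet (Z₂ : Set (Finset α))) (hZ₃ : IsUpperSet (Z₃ : Set (Finset α)))
    (x y₁ y₂ y₃ : Finset α → ℚ) (a b₁ b₂ b₃ : ℚ) (ha : a ≠ 0) (hx : ∀ d, x d ≠ 0 → dᶜ ∈ Y)
    (hy₁ : ∀ d, y₁ d ≠ 0 → dᶜ ∈ Z₁) (hy₂ : ∀ d, y₂ d ≠ 0 → dᶜ ∈ Z₂) (hy₃ : ∀ d, y₃ d ≠ 0 → dᶜ ∈ Z₃)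
    (h : ∀ t, t ∈ Y → a * zsum x t + b₁ * zsum y₁ t + b₂ * zsum y₂ t + b₃ * zsum y₃ t = 0) :
    ∀ e, eᶜ ∉ Z₁ → eᶜ ∉ Z₂ → eᶜ ∉ Z₃ → x e = 0 := by
  have hZ : IsUpperSet ((Z₂ ∪ Z₃ : Finset (Finset α)) : Set (Finset α)) := by
    rw [coe_union]; exact hZ₂.union hZ₃
  have key := diag_read₂ hY hZ₁ hZ x y₁ (fun d => b₂ * y₂ d + b₃ * y₃ d) a b₁ 1 ha hx hy₁ ?_ ?_
  · intro e he₁ he₂ he₃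
    have hne : eᶜ ∉ Z₂ ∪ Z₃ := by
      rw [mem_union]; rintro (h' | h'); exacts [he₂ h', he₃ h']
    exact key e he₁ hne
  · intro d hd
    rw [mem_union]
    by_cases h2 : y₂ d = 0
    · have h3 : y₃ d ≠ 0 := by
        intro h3; apply hd; rw [h2, h3, mul_zero, mul_zero, add_zero]
      exact Or.inr (hy₃ d h3)
    · exact Or.inl (hy₂ d h2)
  · intro t ht
    rw [zsum_mul_add_mul, one_mul, ← add_assoc]
    exact h t ht

/-! ### The two-class extension rule -/

/-- **TWO-CLASS EXTENSION.**  `Y, Zx, Zy` up-sets; `x` supported on `{d : dᶜ ∈ Zx}`, `y` on `{d : dᶜ ∈ Zy}`; on `Y` the relation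
`a·zsum x + b·zsum y = 0` holds with `a ≠ 0`, and `zsum x` vanishes on `Y ∩ Zx ∩ Zy`.  Then `zsum x` vanishes on all of `Y` (and hence so does
`b·zsum y`).  Proof: in the antipodal basis of `ℚ^Y` the coordinates of `zsum x|_Y` live on `refl (Y ∩ Zx)`, those of `zsum y|_Y` on `refl (Y ∩ Zy)`;
by C1 on `Y` they are proportional, so the former live on `refl (Y ∩ Zx ∩ Zy)`, where C1 on the up-set `Y ∩ Zx ∩ Zy` kills them. [this work] -/
theorem zsum_ext₂ {Y Zx Zy : Finset (Finset α)} (hY : IsUpperSet (Y : Set (Finset α)))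
    (hZx : IsUpperSet (Zx : Set (Finset α))) (hZy : IsUpperSet (Zy : Set (Finset α))) (x y : Finset α → ℚ) (a b : ℚ) (ha : a ≠ 0)
    (hx : ∀ d, x d ≠ 0 → dᶜ ∈ Zx) (hy : ∀ d, y d ≠ 0 → dᶜ ∈ Zy)
    (h : ∀ t, t ∈ Y → a * zsum x t + b * zsum y t = 0)
    (h0 : ∀ t, t ∈ Y → t ∈ Zx → t ∈ Zy → zsum x t = 0) : ∀ t, t ∈ Y → zsum x t = 0 := by
  -- support lemma on `Y`
  choose c _hcδ hcsupp hcid using fun d => exists_support_coef hY d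
  -- transfer identity: re-expansion in the coordinates has the same values on `Y`
  have transfer : ∀ (z : Finset α → ℚ), ∀ t, t ∈ Y →
      ∑ e, (∑ d, z d * c d e) * (if e ⊆ t then (1 : ℚ) else 0) = zsum z t := by
    intro z t ht
    unfold zsum
    calc ∑ e, (∑ d, z d * c d e) * (if e ⊆ t then (1 : ℚ) else 0)
        = ∑ e, ∑ d, z d * (c d e * (if e ⊆ t then (1 : ℚ) else 0)) := by
          refine sum_congr rfl fun e _ => ?_
          rw [Finset.sum_mul]
          refine sum_congr rfl fun d _ => ?_
          ring
      _ = ∑ d, ∑ e, z d * (c d e * (if e ⊆ t then (1 : ℚ) else 0)) := Finset.sum_comm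
      _ = ∑ d, z d * ∑ e, c d e * (if e ⊆ t then (1 : ℚ) else 0) := by
          refine sum_congr rfl fun d _ => ?_
          rw [Finset.mul_sum]
      _ = ∑ d, z d * (if d ⊆ t then (1 : ℚ) else 0) := by
          refine sum_congr rfl fun d _ => ?_
          rw [← hcid d t ht]
  -- supports of coordinate vectors
  have suppOf : ∀ (z : Finset α → ℚ) (Z : Finset (Finset α)), IsUpperSet (Z : Set (Finset α)) →
      (∀ d, z d ≠ 0 → dᶜ ∈ Z) → ∀ e, (∑ d, z d * c d e) ≠ 0 → eᶜ ∈ Y ∧ eᶜ ∈ Z := by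
    intro z Z hZ hz e he
    obtain ⟨d, -, hd⟩ := Finset.exists_ne_zero_of_sum_ne_zero he
    obtain ⟨heY, hed⟩ := hcsupp d e (right_ne_zero_of_mul hd)
    exact ⟨heY, hZ (compl_subset_compl.2 hed) (hz d (left_ne_zero_of_mul hd))⟩
  obtain ⟨gx, hgx⟩ : ∃ f : Finset α → ℚ, ∀ e, f e = ∑ d, x d * c d e := ⟨_, fun _ => rfl⟩
  obtain ⟨gy, hgy⟩ : ∃ f : Finset α → ℚ, ∀ e, f e = ∑ d, y d * c d e := ⟨_, fun _ => rfl⟩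
  have hgxsupp : ∀ e, gx e ≠ 0 → eᶜ ∈ Y ∧ eᶜ ∈ Zx := fun e he =>
    suppOf x Zx hZx hx e (by rwa [hgx e] at he)
  have hgysupp : ∀ e, gy e ≠ 0 → eᶜ ∈ Y ∧ eᶜ ∈ Zy := fun e he =>
    suppOf y Zy hZy hy e (by rwa [hgy e] at he)
  -- C1 on `Y`: `a·gx + b·gy = 0`
  have hrel : ∀ e, a * gx e + b * gy e = 0 := by
    refine eq_zero_of_zeta_sum_eq_zero hY (fun e => a * gx e + b * gy e) ?_ ?_
    · intro e he
      by_contra hY'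
      have h1 : gx e = 0 := by by_contra h'; exact hY' (hgxsupp e h').1
      have h2 : gy e = 0 := by by_contra h'; exact hY' (hgysupp e h').1
      apply he
      rw [h1, h2, mul_zero, mul_zero, add_zero]
    · intro t ht
      have hs : ∑ e, (a * gx e + b * gy e) * (if e ⊆ t then (1 : ℚ) else 0)
          = a * ∑ e, (∑ d, x d * c d e) * (if e ⊆ t then (1 : ℚ) else 0)
            + b * ∑ e, (∑ d, y d * c d e) * (if e ⊆ t then (1 : ℚ) else 0) := by
        rw [Finset.mul_sum, Finset.mul_sum, ← Finset.sum_add_distrib]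
        refine Finset.sum_congr rfl fun e _ => ?_
        rw [hgx e, hgy e]
        ring
      rw [hs, transfer x t ht, transfer y t ht]
      exact h t ht
  -- hence `gx` lives on `refl (Y ∩ Zx ∩ Zy)`
  have hW : IsUpperSet ((Y ∩ Zx ∩ Zy : Finset (Finset α)) : Set (Finset α)) := by
    rw [coe_inter, coe_inter]; exact (hY.inter hZx).inter hZy
  have hgxsupp2 : ∀ e, gx e ≠ 0 → eᶜ ∈ Y ∩ Zx ∩ Zy := by
    intro e he
    have hy' : gy e ≠ 0 := by
      intro h0
      have h1 := hrel e
      rw [h0, mul_zero, add_zero] at h1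
      rcases mul_eq_zero.1 h1 with h2 | h2
      · exact ha h2
      · exact he h2
    exact mem_inter.2 ⟨mem_inter.2 (hgxsupp e he), (hgysupp e hy').2⟩
  -- C1 on `Y ∩ Zx ∩ Zy` kills `gx`
  have hgx0 : ∀ e, gx e = 0 := by
    refine eq_zero_of_zeta_sum_eq_zero hW gx hgxsupp2 ?_
    intro t ht
    have htY : t ∈ Y := (mem_inter.1 (mem_inter.1 ht).1).1
    rw [Finset.sum_congr rfl fun e _ => by rw [hgx e], transfer x t htY]
    exact h0 t htY (mem_inter.1 (mem_inter.1 ht).1).2 (mem_inter.1 ht).2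
  -- so `zsum x` vanishes on `Y`
  intro t ht
  rw [← transfer x t ht]
  refine Finset.sum_eq_zero fun e _ => ?_
  rw [← hgx e, hgx0 e, zero_mul]

/-- Companion of `zsum_ext₂`: under the same hypotheses the second combination `b·zsum y` vanishes on `Y` as well. [this work] -/
theorem zsum_ext₂_right {Y Zx Zy : Finset (Finset α)} (hY : IsUpperSet (Y : Set (Finset α)))
    (hZx : IsUpperSet (Zx : Set (Finset α))) (hZy : IsUpperSet (Zy : Set (Finset α))) (x y : Finset α → ℚ) (a b : ℚ) (ha : a ≠ 0)
    (hx : ∀ d, x d ≠ 0 → dᶜ ∈ Zx) (hy : ∀ d, y d ≠ 0 → dᶜ ∈ Zy)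
    (h : ∀ t, t ∈ Y → a * zsum x t + b * zsum y t = 0)
    (h0 : ∀ t, t ∈ Y → t ∈ Zx → t ∈ Zy → zsum x t = 0) : ∀ t, t ∈ Y → b * zsum y t = 0 := by
  intro t ht
  have h1 := h t ht
  rw [zsum_ext₂ hY hZx hZy x y a b ha hx hy h h0 t ht, mul_zero, zero_add] at h1
  exact h1

end FiveUpSet

end Summit.CriticalPhenomena.PercolationContinuityZ3.Theorems
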